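import Summits.BirchSwinnertonDyer.Rank1Residual.GaloisImage.KatoKuriharaValueGeneralLevelParity
import HarnessLib

/-!
# Route `KimAtThreeKolyvagin` (rung W2), additive-DEFECT rows of cruxes 19562 / 19599 / 19679: the
# TWO-EXPONENT general-level VALUE LAW of the Kato–Kurihara port on the parity road
# (`p^e · Λfin(loc_v κ_r) = u · p^t · δ̃` for THEOREM D's own class `κ_r`)

Cell `bsd-addord`, seat `bsd-addord-w2-acc6` (PROGRAMME PART 1b, plan g16 ACCEL-LIST (6)); `--supports`
stmt-BirchSwinnertonDyer-19599 (helper; the item OWNER assembles).  TOOL THEOREMS ONLY: no definition, no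
named fact, no instance, no `sorry`; Kato's `ZetaBody` (witnesses BOUND, never obtained) and the two-exponent
finite-level dual-exponential rider enter as DISPLAYED hypotheses; nothing is asserted about any curve;
nothing is booked; crux 19599 stays OPEN.

## Why (diagnosis of record, seat acc6 gen 2)

Team n1011's discharger ★ PK-6₂ of the Kato-stratum port PORT″
(`GaloisImage.katoKuriharaPortThreeAtWith₂_zero_of_zetaBody`) never reads PORT″'s antecedents `¬ 3 ∣ c₃`,
`¬ 3 ∣ c_P`, `Ω(W) = u·Ω⁺_f`: the whole Kato-stratum content of the port sits in the (P-EXP) rider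
`KatoExpStarFiniteLevelAt W p k t v Λ Λfin` — clause (i): `Λfin` is onto `ℤ/p^{k+1}` on `𝓕_can(v)` with
kernel the Kummer part; clause (ii): `p^t · Λ_{0,r}(y) ≡ s ⊗ 1 (mod p^{k+1} L_int) ⟹ Λfin(loc_v κ₀) = s̄`
— and in the `ω`-normalisation `hNorm` of Kato's constant.  On the additive-DEFECT rows (Kodaira IV/IV*,
`exp*_ω(H¹(ℚ₃,T)) = 3^{v₃(c₃) − t} ℤ₃` — Kim AJM 148 §3.2.3 with Thm. 3.6, cell memo kim3 Lemma L/L′ — or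
`3 ∣ c_P`, `‖Ω(W)/Ω⁺_{P.f}‖₃ = ‖c_P‖₃`, tree `KimAtThreeShallowEqDeepPeriod.exists_optimal_period_ratio`)
clauses (i) and (ii) cannot BOTH hold for Kato's witnesses in any coordinate: the onto-normalised functional is
`Λfin = ι ∘ 3^{t−e} · Λ` with `e = v₃(c₃) + v₃(c_P) ≥ 1`, so that (ii) holds only in the TWO-EXPONENT form
**(ii₂) `p^t · Λ_{0,r}(y) ≡ s ⊗ 1 ⟹ p^e · Λfin(loc_v κ₀) = s̄`**.  n1011's value-law chain
(`KatoParity.apply_localization_add_self_eq_toZModPow` → `…_of_zetaBody_deriv` →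
`KatoValue.GeneralLevel.apply_localization_add_self_eq_toZModPow_of_derivativeFamily` →
`…exists_unit_apply_localization_eq_of_derivativeFamily`) consumes ONLY clause (ii); this file re-runs it
BY NAME over n1011's public lemmas with (ii₂) displayed in place of the rider, producing the value clause
(DICT3₂) `p^e · Λfin(loc_v κ_d) = u_d · p^t · δ̃_{n(d)}` of seat acc6's two-exponent witness predicate
`KimAtThreeKolyvaginDefs.KatoKuriharaWitnessAtTwoExp` (p461408).  General `p`, `k`, `t`, `e`; `v ∣ p`.
At `e = 0` every statement here IS n1011's (`p^0 = 1`).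

## What

* `apply_localization_add_self_eq_toZModPow_of_zetaBody_deriv_twoExp` — (ii₂) applied to the plus-symmetrised
  pair `(y + g·y, κ₀ + κ₀)` for THEOREM A3's derivative `y = D · z_{0,r}`, premise on the pure tensor
  `1 ⊗ D^{field}(x_{0,r} + σ₋₁ x_{0,r})` (n1011 (T⁺1) `KatoParity.resSubgroup_add_self_eq_apply_add_conjMap`,
  (T⁺2) `ZetaValue.zetaBody_apply_deriv_zeta_add_conjMap_eq_tmul_deriv`).
* `apply_localization_add_self_eq_toZModPow_of_derivativeFamily_twoExp` — THEOREM D's literal currency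
  (n1011 (S1) `KatoValue.GeneralLevel.resSubgroup_eq_comp_map_deriv`, (S2)
  `…localization_mem_of_isKolyvaginSystem`, pin glue `KatoValue.comp_oneCocycleClass_eq_of_pin`).
* `exists_unit_mul_apply_eq_of_add_self` — with the unit reading of the scalar (`s̄ = w · p^t · δ̃`):
  `∃ u ∈ (ℤ/p^{k+1})ˣ, p^e · Λfin(loc_v κ_r) = u · p^t · δ̃` (halving, `p` odd; pure algebra).

References: [Kato2004Asterisque] §9.4 (p. 188), Thm. 9.7 (p. 189); [Kim2022StructureSelmer] §3.2.3, Thm. 3.6,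
Rem. 3.7, Lemma 3.9, §3.4.1 and the proof of Thm. 3.13 (arXiv pp. 16–18, 26–27); [MazurRubin2004] Thm. 3.2.4,
App. A; [Rubin2000] Def. 4.4.4; [Kim2025RefinedTNC] §4.2, Rem. 4.1, §8.1.2; cell files
`run/shared/lean/pub/bsd-addord/kim3/KIM3-PROOF.md` §4 (Lemma L/L′), seat memo W2ACC6-TWOEXP-g0.md.
-/

set_option autoImplicit false
-- the Theorems namespace of a single-conjunct summit repeats the summit name by design (D-0017)
set_option linter.dupNamespace false

noncomputable section

open scoped NumberField TensorProduct
open CategoryTheory Field Finset IsDedekindDomain NumberField WeierstrassCurve Rat.HeightOneSpectrum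
open Literature.NumberTheory.GaloisRepresentations Literature.NumberTheory.GaloisCohomology
open Literature.NumberTheory.GaloisRepresentations.DiscreteGaloisModule
open Literature.NumberTheory.EllipticCurves Literature.NumberTheory.EllipticCurves.Kato2004
open Literature.NumberTheory.EllipticCurves.Kato2004.EulerSystemValues
open Summit.BirchSwinnertonDyer.Rank1Residual.GaloisImage

namespace Summit.BirchSwinnertonDyer.BirchSwinnertonDyer.Theorems.KimAtThreeTwoExponentValueLaw


/-! ### §1 With Kato's `ZetaBody`: (ii₂) on the symmetrised derivative pair -/

section Zeta

variable (W : WeierstrassCurve ℚ) [W.IsElliptic] (p : ℕ) [Fact p.Prime]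
  [ContinuousSMul ℤ_[p] (W.tateModule p)] [Module.Free ℤ_[p] (W.tateModule p)]
  [Module.Finite ℤ_[p] (W.tateModule p)] {N : ℕ} (f : CuspForm (CongruenceSubgroup.Gamma0 N) 2)
  (ι : (m : ℕ) → (CyclotomicField m ℚ →+* ℂ)) (κK : ℝ)
  (Λ : ∀ (k' : ℕ) (r : Finset (HeightOneSpectrum (𝓞 ℚ))),
    H1 (tateRep W p) (cycSubgroup p k' r) →ₗ[ℤ_[p]] ℚ_[p] ⊗[ℚ] CyclotomicField (cycLevel p k' r) ℚ)
  (c d a : ℤ) (A : ℕ)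
  (z : ∀ (k' : ℕ) (r : (cyclotomicLevelsRat p (badPlaces c d A N)).Ideals),
    H1 (tateRep W p) ((cyclotomicLevelsRat p (badPlaces c d A N)).level k' r.1))
  (x : ∀ (k' : ℕ) (r : (cyclotomicLevelsRat p (badPlaces c d A N)).Ideals),
    CyclotomicField (cycLevel p k' r.1) ℚ)

/-- Local notation: `𝓛` = the levels of Kato's Euler system for the auxiliary datum `(c, d, A)`. -/
local notation3 "𝓛" => cyclotomicLevelsRat p (badPlaces c d A N)

/-- Local notation: `𝐃⟦X, U, τ⟧ ℓ = ∑_{j < ℓ−1} j·(τ_ℓ)_*^j` on `H¹(U, X)` (THEOREM D's `ℤ`-spelling). -/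
local notation3 (prettyPrint := false) "𝐃⟦" X ", " U ", " τ "⟧" =>
  fun ℓ : HeightOneSpectrum (𝓞 ℚ) =>
  ∑ j ∈ Finset.range (((primesEquiv ℓ : Nat.Primes) : ℕ) - 1),
    (j : Module.End ℤ (continuousCohomology 1 (subgroupRep X U))) *
      (conjMap X U ((τ : HeightOneSpectrum (𝓞 ℚ) → absoluteGaloisGroup ℚ) ℓ) 1).hom.toLinearMap ^ j

/-- Local notation: `𝐃F⟦r, τ⟧ ℓ` = the same operator on the level FIELD `ℚ(ζ_{m(0,r)})`. -/
local notation3 (prettyPrint := false) "𝐃F⟦" r ", " τ "⟧" =>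
  fun ℓ : HeightOneSpectrum (𝓞 ℚ) =>
  ∑ j ∈ Finset.range (((primesEquiv ℓ : Nat.Primes) : ℕ) - 1),
    (j : Module.End ℚ (CyclotomicField (cycLevel p 0 r) ℚ)) *
      (sigma (cycLevel p 0 r) (modNCyclotomicCharacter ℚ (cycLevel p 0 r)
          ((τ : HeightOneSpectrum (𝓞 ℚ) → absoluteGaloisGroup ℚ) ℓ)) :
        CyclotomicField (cycLevel p 0 r) ℚ →ₐ[ℚ] CyclotomicField (cycLevel p 0 r) ℚ).toLinearMap ^ j

/-- **(T⁺1) ∘ (T⁺2), two-exponent form, for THEOREM A3's derivative `y = D · z_{0,r}`**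
(`D = ∏_{ℓ∈s} Σ_{j<N_ℓ} j·σ_ℓ^j`): under `hbody` and the displayed clause (ii₂), for `g` with `χ_n(g) = −1`,
from `res κ₀ = Ψ (D·z_{0,r})`, `loc_v κ₀ ∈ 𝓕_can(v)` and the premise on the PURE TENSOR
`p^t · (1 ⊗ D^{field}(x_{0,r} + σ₋₁ x_{0,r})) ≡ s ⊗ 1 (mod p^{k+1}·L_int)`:
`p^e · Λfin(loc_v (κ₀ + κ₀)) = s mod p^{k+1}` (the value of `D·z + g·(D·z)` is n1011's
`ZetaValue.zetaBody_apply_deriv_zeta_add_conjMap_eq_tmul_deriv`; (T⁺1) is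
`KatoParity.resSubgroup_add_self_eq_apply_add_conjMap`).  At `e = 0` this is
`KatoParity.apply_localization_add_self_eq_toZModPow_of_zetaBody_deriv`.
[cite: Kato2004Asterisque, Thm. 9.7 (p. 189) and §9.4 (p. 188)]
[cite: Kim2022StructureSelmer, §3.4.1 and the proof of Thm. 3.13 (arXiv v3 pp. 26–27; = Thm. 3.11 of AJM 148)] -/
theorem apply_localization_add_self_eq_toZModPow_of_zetaBody_deriv_twoExp
    (hbody : ZetaBody W p f ι κK Λ c d a A z x)
    {k t e : ℕ} {v : HeightOneSpectrum (𝓞 ℚ)}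
    {Λfin : galoisCohomology ((W.torsionGaloisModule ((p : ℤ) ^ k * (p : ℤ))).toLocal
      (Sum.inr v)) 1 →+ ZMod (p ^ (k + 1))}
    (hfin₂ : ∀ (r : Finset (HeightOneSpectrum (𝓞 ℚ)))
      (Ψ : H1 (tateRep W p) (cycSubgroup p 0 r) →+
        continuousCohomology 1
          (subgroupRep (W.torsionGaloisModule ((p : ℤ) ^ k * (p : ℤ))).toTopRep (cycSubgroup p 0 r))),
      (∀ (φ : contOneCocycles (subgroupRep (tateRep W p).toTopRep (cycSubgroup p 0 r)))
          (ψ : contOneCocycles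
            (subgroupRep (W.torsionGaloisModule ((p : ℤ) ^ k * (p : ℤ))).toTopRep (cycSubgroup p 0 r))),
          (∀ g, ((ψ.1 g : geomTorsion W ((p : ℤ) ^ k * (p : ℤ))) : geomPoints W) =
            TateModule.proj p (k + 1) (φ.1 g)) →
          Ψ (oneCocycleClass _ φ) = oneCocycleClass _ ψ) →
      ∀ (y : H1 (tateRep W p) (cycSubgroup p 0 r))
        (κ₀ : galoisCohomology (W.torsionGaloisModule ((p : ℤ) ^ k * (p : ℤ))) 1) (s : ℤ_[p]),
        resSubgroup (W.torsionGaloisModule ((p : ℤ) ^ k * (p : ℤ))).toTopRep (cycSubgroup p 0 r) 1 κ₀ =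
            Ψ y →
        galoisCohomology.localization (W.torsionGaloisModule ((p : ℤ) ^ k * (p : ℤ))) (Sum.inr v) 1 κ₀ ∈
            propagatedSelmerStructure W p k (Sum.inr v) →
        (∃ l ∈ cycIntLattice p (cycLevel p 0 r),
            ((p : ℤ_[p]) ^ t) • Λ 0 r y - ((s : ℚ_[p]) ⊗ₜ[ℚ] (1 : CyclotomicField (cycLevel p 0 r) ℚ)) =
              ((p : ℤ_[p]) ^ (k + 1)) • (l : ℚ_[p] ⊗[ℚ] CyclotomicField (cycLevel p 0 r) ℚ)) →
        ((p ^ e : ℕ) : ZMod (p ^ (k + 1))) *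
          Λfin (galoisCohomology.localization (W.torsionGaloisModule ((p : ℤ) ^ k * (p : ℤ)))
            (Sum.inr v) 1 κ₀) = PadicInt.toZModPow (k + 1) s)
    (r : (𝓛).Ideals)
    (Ψ : H1 (tateRep W p) (cycSubgroup p 0 r.1) →+
      continuousCohomology 1
        (subgroupRep (W.torsionGaloisModule ((p : ℤ) ^ k * (p : ℤ))).toTopRep (cycSubgroup p 0 r.1)))
    (hΨ : ∀ (φ : contOneCocycles (subgroupRep (tateRep W p).toTopRep (cycSubgroup p 0 r.1)))
        (ψ : contOneCocycles
          (subgroupRep (W.torsionGaloisModule ((p : ℤ) ^ k * (p : ℤ))).toTopRep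
            (cycSubgroup p 0 r.1))),
        (∀ g, ((ψ.1 g : geomTorsion W ((p : ℤ) ^ k * (p : ℤ))) : geomPoints W) =
          TateModule.proj p (k + 1) (φ.1 g)) →
        Ψ (oneCocycleClass _ φ) = oneCocycleClass _ ψ)
    {ι' : Type*} (σ : ι' → absoluteGaloisGroup ℚ) (Nℓ : ι' → ℕ) (s' : Finset ι') (comm)
    {g : absoluteGaloisGroup ℚ} (hg : modNCyclotomicCharacter ℚ (cycLevel p 0 r.1) g = -1)
    (κ₀ : galoisCohomology (W.torsionGaloisModule ((p : ℤ) ^ k * (p : ℤ))) 1) (s : ℤ_[p])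
    (hres : resSubgroup (W.torsionGaloisModule ((p : ℤ) ^ k * (p : ℤ))).toTopRep (cycSubgroup p 0 r.1)
      1 κ₀ = Ψ (s'.noncommProd (fun ℓ => ∑ j ∈ Finset.range (Nℓ ℓ),
        (j : Module.End ℤ_[p] (H1 (tateRep W p) (cycSubgroup p 0 r.1))) *
          (conjMap (tateRep W p).toTopRep (cycSubgroup p 0 r.1) (σ ℓ) 1).hom.toLinearMap ^ j) comm
            (z 0 r)))
    (hloc : galoisCohomology.localization (W.torsionGaloisModule ((p : ℤ) ^ k * (p : ℤ))) (Sum.inr v)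
      1 κ₀ ∈ propagatedSelmerStructure W p k (Sum.inr v))
    (hval : ∃ l ∈ cycIntLattice p (cycLevel p 0 r.1),
      ((p : ℤ_[p]) ^ t) • ((1 : ℚ_[p]) ⊗ₜ[ℚ]
        (s'.noncommProd (fun ℓ => ∑ j ∈ Finset.range (Nℓ ℓ),
            (j : Module.End ℚ (CyclotomicField (cycLevel p 0 r.1) ℚ)) *
              (sigma (cycLevel p 0 r.1) (modNCyclotomicCharacter ℚ (cycLevel p 0 r.1) (σ ℓ)) :
                CyclotomicField (cycLevel p 0 r.1) ℚ →ₐ[ℚ]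
                  CyclotomicField (cycLevel p 0 r.1) ℚ).toLinearMap ^ j)
            (ZetaValue.pairwise_commute_fieldDeriv (cycLevel p 0 r.1)
              (fun ℓ => modNCyclotomicCharacter ℚ (cycLevel p 0 r.1) (σ ℓ)) Nℓ s')
          (x 0 r + sigma (cycLevel p 0 r.1) (-1) (x 0 r)))) -
          ((s : ℚ_[p]) ⊗ₜ[ℚ] (1 : CyclotomicField (cycLevel p 0 r.1) ℚ)) =
        ((p : ℤ_[p]) ^ (k + 1)) • (l : ℚ_[p] ⊗[ℚ] CyclotomicField (cycLevel p 0 r.1) ℚ)) :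
    ((p ^ e : ℕ) : ZMod (p ^ (k + 1))) *
      Λfin (galoisCohomology.localization (W.torsionGaloisModule ((p : ℤ) ^ k * (p : ℤ)))
        (Sum.inr v) 1 (κ₀ + κ₀)) = PadicInt.toZModPow (k + 1) s := by
  -- (T⁺1): `res (κ₀ + κ₀) = Ψ (y + g·y)`; `loc_v (κ₀ + κ₀) ∈ 𝓕_can(v)`; then (ii₂) with the premise moved
  -- onto `Λ_{0,r}(y + g·y)` by (T⁺2)
  refine hfin₂ r.1 Ψ hΨ _ (κ₀ + κ₀) s
    (KatoParity.resSubgroup_add_self_eq_apply_add_conjMap _ Ψ hΨ g _ κ₀ hres)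
    (KatoParity.localization_add_self_mem hloc) ?_
  rwa [ZetaValue.zetaBody_apply_deriv_zeta_add_conjMap_eq_tmul_deriv W p f ι κK Λ c d a A z x hbody 0
    r σ Nℓ s' comm hg]

/-! ### §2 THEOREM D's literal currency -/

/-- **★★ THE TWO-EXPONENT GENERAL-LEVEL VALUE LAW ON THE PARITY ROAD, THEOREM D's LITERAL CURRENCY.**
Data: Kato's witnesses bound by `hbody`; the two-exponent rider clause (ii₂) `hfin₂` at `v ∣ p` (displayed);
a pinned coefficient system `(T′, red, e)`; a datum `D` with `𝒫 ⊆ 𝓛.primes`; THEOREM D's output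
`(σ, Φ, comm, κ)` for the Euler system `z` EXACTLY as displayed by n1011's D4/D6/D7 (`hΦ`, `hKS`, `hres`); a
level `r ⊆ 𝒫`; a scalar `s`.  IF `p^t · (1 ⊗ D^{field}_r (x_{0,r} + σ₋₁ x_{0,r})) − s ⊗ 1 ∈ p^{k+1} · L_int`
THEN `p^e · Λfin (loc_v (κ_r + κ_r)) = s mod p^{k+1}`.  Proof = n1011's (S1) + (S2) + pin glue + (T⁺2) by
name, the conjugation with `χ_{m(0,r)} = −1` obtained inside; at `e = 0` this is
`KatoValue.GeneralLevel.apply_localization_add_self_eq_toZModPow_of_derivativeFamily`.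
[cite: Kato2004Asterisque, §9.4 (p. 188) and Thm. 9.7 (p. 189)]
[cite: Kim2022StructureSelmer, §3.4.1 and the proof of Thm. 3.13 (arXiv v3 pp. 26–27; = Thm. 3.11 of AJM 148)]
[cite: MazurRubin2004, Thm. 3.2.4 and App. A] [cite: Rubin2000, Def. 4.4.4] -/
theorem apply_localization_add_self_eq_toZModPow_of_derivativeFamily_twoExp
    (hbody : ZetaBody W p f ι κK Λ c d a A z x)
    {k t e : ℕ} {v : HeightOneSpectrum (𝓞 ℚ)}
    {Λfin : galoisCohomology ((W.torsionGaloisModule ((p : ℤ) ^ k * (p : ℤ))).toLocal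
      (Sum.inr v)) 1 →+ ZMod (p ^ (k + 1))}
    (hfin₂ : ∀ (r : Finset (HeightOneSpectrum (𝓞 ℚ)))
      (Ψ : H1 (tateRep W p) (cycSubgroup p 0 r) →+
        continuousCohomology 1
          (subgroupRep (W.torsionGaloisModule ((p : ℤ) ^ k * (p : ℤ))).toTopRep (cycSubgroup p 0 r))),
      (∀ (φ : contOneCocycles (subgroupRep (tateRep W p).toTopRep (cycSubgroup p 0 r)))
          (ψ : contOneCocycles
            (subgroupRep (W.torsionGaloisModule ((p : ℤ) ^ k * (p : ℤ))).toTopRep (cycSubgroup p 0 r))),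
          (∀ g, ((ψ.1 g : geomTorsion W ((p : ℤ) ^ k * (p : ℤ))) : geomPoints W) =
            TateModule.proj p (k + 1) (φ.1 g)) →
          Ψ (oneCocycleClass _ φ) = oneCocycleClass _ ψ) →
      ∀ (y : H1 (tateRep W p) (cycSubgroup p 0 r))
        (κ₀ : galoisCohomology (W.torsionGaloisModule ((p : ℤ) ^ k * (p : ℤ))) 1) (s : ℤ_[p]),
        resSubgroup (W.torsionGaloisModule ((p : ℤ) ^ k * (p : ℤ))).toTopRep (cycSubgroup p 0 r) 1 κ₀ =
            Ψ y →
        galoisCohomology.localization (W.torsionGaloisModule ((p : ℤ) ^ k * (p : ℤ))) (Sum.inr v) 1 κ₀ ∈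
            propagatedSelmerStructure W p k (Sum.inr v) →
        (∃ l ∈ cycIntLattice p (cycLevel p 0 r),
            ((p : ℤ_[p]) ^ t) • Λ 0 r y - ((s : ℚ_[p]) ⊗ₜ[ℚ] (1 : CyclotomicField (cycLevel p 0 r) ℚ)) =
              ((p : ℤ_[p]) ^ (k + 1)) • (l : ℚ_[p] ⊗[ℚ] CyclotomicField (cycLevel p 0 r) ℚ)) →
        ((p ^ e : ℕ) : ZMod (p ^ (k + 1))) *
          Λfin (galoisCohomology.localization (W.torsionGaloisModule ((p : ℤ) ^ k * (p : ℤ)))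
            (Sum.inr v) 1 κ₀) = PadicInt.toZModPow (k + 1) s)
    {M' : Type} [AddCommGroup M'] [Module ℤ_[p] M'] [TopologicalSpace M'] [IsTopologicalAddGroup M']
    [ContinuousSMul ℤ_[p] M'] {T' : GaloisRep ℚ ℤ_[p] M'}
    (red : (tateRep W p).toTopRep ⟶ T'.toTopRep)
    (e' : M' →+ geomTorsion W ((p : ℤ) ^ k * (p : ℤ))) (hec : Continuous e')
    (he : ∀ (g : absoluteGaloisGroup ℚ) (y : M'),
      e' (T'.toTopRep.ρ g y) = (W.torsionGaloisModule ((p : ℤ) ^ k * (p : ℤ))).toTopRep.ρ g (e' y))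
    (hpin : ∀ b : W.tateModule p,
      ((e' (red.hom b) : geomTorsion W ((p : ℤ) ^ k * (p : ℤ))) : geomPoints W) =
        TateModule.proj p (k + 1) b)
    (D : KolyvaginDatum (W.torsionGaloisModule ((p : ℤ) ^ k * (p : ℤ))))
    (hPr : D.primes ⊆ (𝓛).primes)
    (σ : HeightOneSpectrum (𝓞 ℚ) → absoluteGaloisGroup ℚ)
    (Φ : ∀ r : Finset (HeightOneSpectrum (𝓞 ℚ)),
      continuousCohomology 1 (subgroupRep T'.toTopRep ((𝓛).level ⊥ r)) →+
        continuousCohomology 1 (subgroupRep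
          (W.torsionGaloisModule ((p : ℤ) ^ k * (p : ℤ))).toTopRep ((𝓛).level ⊥ r)))
    (comm : ∀ r : Finset (HeightOneSpectrum (𝓞 ℚ)),
      ((r : Finset _) : Set (HeightOneSpectrum (𝓞 ℚ))).Pairwise fun a' b' =>
        Commute (𝐃⟦(W.torsionGaloisModule ((p : ℤ) ^ k * (p : ℤ))).toTopRep, ((𝓛).level ⊥ r), σ⟧ a')
          (𝐃⟦(W.torsionGaloisModule ((p : ℤ) ^ k * (p : ℤ))).toTopRep, ((𝓛).level ⊥ r), σ⟧ b'))
    (κ : Finset (HeightOneSpectrum (𝓞 ℚ)) →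
      galoisCohomology (W.torsionGaloisModule ((p : ℤ) ^ k * (p : ℤ))) 1)
    (hΦ : ∀ r, ∀ (φ : contOneCocycles (subgroupRep T'.toTopRep ((𝓛).level ⊥ r)))
      (ψ : contOneCocycles (subgroupRep
        (W.torsionGaloisModule ((p : ℤ) ^ k * (p : ℤ))).toTopRep ((𝓛).level ⊥ r))),
      (∀ g, ψ.1 g = e' (φ.1 g)) → Φ r (oneCocycleClass _ φ) = oneCocycleClass _ ψ)
    (hKS : D.IsKolyvaginSystem (propagatedSelmerStructure W p k) κ)
    (hres : ∀ (r : Finset (HeightOneSpectrum (𝓞 ℚ))) (hr : (↑r : Set _) ⊆ D.primes),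
      resSubgroup (W.torsionGaloisModule ((p : ℤ) ^ k * (p : ℤ))).toTopRep ((𝓛).level ⊥ r) 1 (κ r) =
        (r.noncommProd 𝐃⟦(W.torsionGaloisModule ((p : ℤ) ^ k * (p : ℤ))).toTopRep,
            ((𝓛).level ⊥ r), σ⟧ (comm r))
          (Φ r (ContinuousCohomology.map (ContinuousMonoidHom.id _)
            (X := subgroupRep (tateRep W p).toTopRep ((𝓛).level ⊥ r))
            (Y := subgroupRep T'.toTopRep ((𝓛).level ⊥ r))
            ((TopRep.resFunctor ((𝓛).level ⊥ r).subtype).map red) 1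
            (z ⊥ ⟨r, fun _ hq => hPr (hr (Finset.mem_coe.2 hq))⟩))))
    (hvp : ((primesEquiv v : Nat.Primes) : ℕ) = p)
    (r : Finset (HeightOneSpectrum (𝓞 ℚ))) (hr : (↑r : Set _) ⊆ D.primes) (s : ℤ_[p])
    (hval : ∃ l ∈ cycIntLattice p (cycLevel p 0 r),
      ((p : ℤ_[p]) ^ t) • ((1 : ℚ_[p]) ⊗ₜ[ℚ]
        ((r.noncommProd 𝐃F⟦r, σ⟧ (ZetaValue.pairwise_commute_fieldDeriv (cycLevel p 0 r)
            (fun ℓ => modNCyclotomicCharacter ℚ (cycLevel p 0 r) (σ ℓ))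
            (fun ℓ => ((primesEquiv ℓ : Nat.Primes) : ℕ) - 1) r))
          (x 0 ⟨r, fun _ hq => hPr (hr (Finset.mem_coe.2 hq))⟩ +
            sigma (cycLevel p 0 r) (-1) (x 0 ⟨r, fun _ hq => hPr (hr (Finset.mem_coe.2 hq))⟩)))) -
          ((s : ℚ_[p]) ⊗ₜ[ℚ] (1 : CyclotomicField (cycLevel p 0 r) ℚ)) =
        ((p : ℤ_[p]) ^ (k + 1)) • (l : ℚ_[p] ⊗[ℚ] CyclotomicField (cycLevel p 0 r) ℚ)) :
    ((p ^ e : ℕ) : ZMod (p ^ (k + 1))) *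
      Λfin (galoisCohomology.localization (W.torsionGaloisModule ((p : ℤ) ^ k * (p : ℤ)))
        (Sum.inr v) 1 (κ r + κ r)) = PadicInt.toZModPow (k + 1) s := by
  -- usable primes are `≠ p`, so `v ∉ r`; clause (0) at `v` by (S2)
  have hvr : v ∉ r := fun hmem => (hPr (hr (Finset.mem_coe.2 hmem))).2 hvp
  have hloc := KatoValue.GeneralLevel.localization_mem_of_isKolyvaginSystem hKS hr hvr
  -- a conjugation of the level: `χ_{m(0,r)}(g) = −1`
  obtain ⟨g, hg⟩ := KatoParity.exists_modNCyclotomicCharacter_eq_neg_one (cycLevel p 0 r)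
  -- `Ψ_r := Φ_r ∘ red_*`, admissible for (ii₂) by the pin glue; `res κ_r = Ψ_r (D^T_r z_{0,r})` by (S1)
  let Ψ : H1 (tateRep W p) (cycSubgroup p 0 r) →+
      continuousCohomology 1
        (subgroupRep (W.torsionGaloisModule ((p : ℤ) ^ k * (p : ℤ))).toTopRep (cycSubgroup p 0 r)) :=
    (Φ r).comp (ContinuousCohomology.map (ContinuousMonoidHom.id (cycSubgroup p 0 r))
        (X := subgroupRep (tateRep W p).toTopRep (cycSubgroup p 0 r))
        (Y := subgroupRep T'.toTopRep (cycSubgroup p 0 r))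
        ((TopRep.resFunctor (cycSubgroup p 0 r).subtype).map red) 1).hom.toLinearMap.toAddMonoidHom
  have hΨ : ∀ (φ : contOneCocycles (subgroupRep (tateRep W p).toTopRep (cycSubgroup p 0 r)))
      (ψ : contOneCocycles
        (subgroupRep (W.torsionGaloisModule ((p : ℤ) ^ k * (p : ℤ))).toTopRep (cycSubgroup p 0 r))),
      (∀ g, ((ψ.1 g : geomTorsion W ((p : ℤ) ^ k * (p : ℤ))) : geomPoints W) =
        TateModule.proj p (k + 1) (φ.1 g)) →
      Ψ (oneCocycleClass _ φ) = oneCocycleClass _ ψ :=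
    fun φ ψ h => KatoValue.comp_oneCocycleClass_eq_of_pin red e' hpin (cycSubgroup p 0 r) (Φ r) (hΦ r) φ ψ h
  have hres' := KatoValue.GeneralLevel.resSubgroup_eq_comp_map_deriv red e' hec he (cycSubgroup p 0 r)
    (Φ r) (hΦ r) σ (fun ℓ => ((primesEquiv ℓ : Nat.Primes) : ℕ) - 1) r
    (KatoValue.GeneralLevel.pairwise_commute_tateDeriv W p r σ
      (fun ℓ => ((primesEquiv ℓ : Nat.Primes) : ℕ) - 1) r)
    (comm r) _ (κ r) (hres r hr)
  exact apply_localization_add_self_eq_toZModPow_of_zetaBody_deriv_twoExp W p f ι κK Λ c d a A z x hbody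
    hfin₂ ⟨r, fun _ hq => hPr (hr (Finset.mem_coe.2 hq))⟩ Ψ hΨ σ
    (fun ℓ => ((primesEquiv ℓ : Nat.Primes) : ℕ) - 1) r
    (KatoValue.GeneralLevel.pairwise_commute_tateDeriv W p r σ
      (fun ℓ => ((primesEquiv ℓ : Nat.Primes) : ℕ) - 1) r) hg (κ r) s hres' hloc hval

/-- **★ THE TWO-EXPONENT VALUE CLAUSE (DICT3₂) for THEOREM D's OWN class, from the doubled clause** (`p` odd):
if `p^e · Λfin(X + X) = s̄` and `s̄ = w · p^t · δ̃` with `w` a unit (n1011 T-PK6-VAL (V4); DISPLAYED), then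
`∃ u ∈ (ℤ/p^{k+1})ˣ, p^e · Λfin X = u · p^t · δ̃` (halving, `KatoParity.isUnit_two_zmod_pow`) — the literal value
clause of seat acc6's `KimAtThreeKolyvaginDefs.KatoKuriharaWitnessAtTwoExp` when `X = loc_v κ_r` and
`δ̃ = kuriharaNumber f (p^(k+1)) n ψ`; fed by `apply_localization_add_self_eq_toZModPow_of_derivativeFamily_twoExp`.
At `e = 0` the pair is n1011's `KatoValue.GeneralLevel.exists_unit_apply_localization_eq_of_derivativeFamily`.
[cite: Kim2022StructureSelmer, Thm. 3.13 and §3.2.3 (arXiv v3 pp. 16–18)] [cite: Kim2025RefinedTNC, §4.2 and §8.1.2] -/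
theorem exists_unit_mul_apply_eq_of_add_self {k t e : ℕ} (hp2 : p ≠ 2) {G : Type*} [AddCommGroup G]
    (Λfin : G →+ ZMod (p ^ (k + 1))) (X : G) {s δ : ZMod (p ^ (k + 1))} (w : (ZMod (p ^ (k + 1)))ˣ)
    (h2 : ((p ^ e : ℕ) : ZMod (p ^ (k + 1))) * Λfin (X + X) = s)
    (hw : s = (w : ZMod (p ^ (k + 1))) * (p : ZMod (p ^ (k + 1))) ^ t * δ) :
    ∃ u : (ZMod (p ^ (k + 1)))ˣ,
      ((p ^ e : ℕ) : ZMod (p ^ (k + 1))) * Λfin X = (u : ZMod (p ^ (k + 1))) * (p : ZMod (p ^ (k + 1))) ^ t * δ := by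
  rw [hw, map_add, ← two_mul] at h2
  have hu := KatoParity.isUnit_two_zmod_pow hp2 k
  have hinv : ((hu.unit⁻¹ : (ZMod (p ^ (k + 1)))ˣ) : ZMod (p ^ (k + 1))) * 2 = 1 := hu.val_inv_mul
  refine ⟨hu.unit⁻¹ * w, ?_⟩
  rw [Units.val_mul]
  linear_combination ((hu.unit⁻¹ : (ZMod (p ^ (k + 1)))ˣ) : ZMod (p ^ (k + 1))) * h2 -
    (((p ^ e : ℕ) : ZMod (p ^ (k + 1))) * Λfin X) * hinv

end Zeta

end Summit.BirchSwinnertonDyer.BirchSwinnertonDyer.Theorems.KimAtThreeTwoExponentValueLaw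

end
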